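import Literature.MathematicalPhysics.QuantumFieldTheory.Balaban1983to89.T3YM3TorusStatement
import Literature.MathematicalPhysics.QuantumFieldTheory.Balaban1983to89.T3ContinuumYM3TorusNonempty
import Literature.MathematicalPhysics.QuantumFieldTheory.Balaban1983to89.T3CovarianceRP
import Literature.MathematicalPhysics.QuantumFieldTheory.LatticeLangevinDynamics
import Literature.MathematicalPhysics.QuantumLattice.RepLieAlgebraUnitary
import HarnessLib

/-!
# Route `ColdStartUniversality`, crux K_A1 `UniformColdStartMixing` (stmt-QuantumFields-24809):
# the plan-only first rung `stub_fixedCutoffMixing` — reduction of FIXED-cut-off cold-start Cesàro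
# mixing in PHYSICAL time to lattice-time ergodicity of the SZZ diffusion + the Gibbs dictionary

Helper file (lead `ym-line-csu-p1`; the crux body K_A1 itself is untouched by order of director-ym).  The
BC5 rung of the line (planner `ym-idea-5` g3) is K_A1 with the physical time `T` chosen AFTER the cut-off
`K`:

  `FixedCutoffMixing` : ∀ F, γ > 0, loop string `os`, δ > 0, K, ∃ T > 0, ∀ (Ω, P, flat Brownian W, cold-start
  strong solution U of (⋆) at β' = (γ ε_K)⁻¹/2), |expectAt K os − T⁻¹ ∫₀ᵀ E[∏_{C ∈ os} avgObs K C (U(s/ε_K))] ds| ≤ δ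

— fixed-lattice ergodicity of the elliptic link diffusion on the compact `SU(2)^E` with invariant measure
the Wilson Gibbs state (SZZ arXiv:2204.12737 Lemma 3.3; Hörmander/Doeblin), read through Bałaban's
expectation `expectAt`.  This file proves the BOOKKEEPING part, sorry-free:
`fixedCutoffMixing_of_latticeErgodic` — the rung follows from

* (E) **lattice-time Cesàro ergodicity from the cold start** of the SZZ diffusion for `SU(2)` on `(ℤ/L)³`
  at coupling `β'`, for bounded measurable observables, with limit the Wilson measure
  `wilsonMeasure (fundamentalRep) β'` (hypothesis `hErg`; the open analytic content: unique invariant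
  measure of an elliptic diffusion on a compact connected group manifold + Krylov–Bogoliubov / Doob);
* (D) **the Gibbs dictionary** `expectAt K os = ∫ (∏ avgObs ∘ bond-dictionary) d wilsonMeasure(β_K/2)`
  (hypothesis `hDict`; Bałaban's `reTr = Re Tr/2` and `expect` vs the tree's `wilsonAction`/`wilsonMeasure`
  over the same plaquette set, bond `b ↦ (b.src, b.dir)`);
* (R) measurability and the bound `|∏ avgObs| ≤ 1` of the observable (hypothesis `hObs`; cf. the
  registered K_A1 stub `stub_integrandRegular`),

by the time change `s = ε_K t` in the Cesàro integral (`T_phys := ε_K · T_lat`).  No definition, no sorry,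
standard axioms.  RECORD-rung R3 plumbing; NOT K_A1 (whose `T` is uniform in `K`), not the mass gap.
-/

set_option autoImplicit false

noncomputable section

namespace Summit.QuantumFields.YangMills.Theorems.ColdStartUniversality

open MeasureTheory ProbabilityTheory intervalIntegral
open scoped NNReal
open Literature.MathematicalPhysics.QuantumFieldTheory
open Literature.MathematicalPhysics.QuantumLattice (fundamentalRep fundamentalLatticeRep)
open Literature.MathematicalPhysics.QuantumFieldTheory.Balaban1983to89

/-- **Time change in a Cesàro mean**: `(εT)⁻¹ ∫₀^{εT} g(s/ε) ds = T⁻¹ ∫₀ᵀ g(t) dt` for `ε ≠ 0`. [folklore] -/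
theorem inv_mul_integral_comp_div (g : ℝ → ℝ) {ε T : ℝ} (hε : ε ≠ 0) (hT : T ≠ 0) :
    (ε * T)⁻¹ * ∫ s in (0 : ℝ)..(ε * T), g (s / ε) = T⁻¹ * ∫ t in (0 : ℝ)..T, g t := by
  rw [intervalIntegral.integral_comp_div g hε, zero_div, smul_eq_mul,
    show ε * T / ε = T by field_simp]
  rw [mul_inv, mul_assoc, ← mul_assoc T⁻¹, mul_comm T⁻¹ ε, ← mul_assoc, ← mul_assoc, inv_mul_cancel₀ hε,
    one_mul]

/-- **The rung from lattice-time ergodicity and the Gibbs dictionary.**  If (E) the cold-start SZZ diffusion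
for `SU(2)` on every `(ℤ/L)³` at every coupling `β'` is Cesàro-ergodic in lattice time for bounded measurable
observables with limit `wilsonMeasure (fundamentalRep (Fin 2)) β'`, (D) Bałaban's step-`K` expectation of a
product of averaged loop variables is the `wilsonMeasure((γ ε_K)⁻¹/2)`-integral of that product read through
the bond dictionary `b ↦ (b.src, b.dir)`, and (R) that product is measurable and bounded by `1`, then for every
`F`, `γ > 0`, `os`, `δ > 0` and `K` there is a PHYSICAL time `T = ε_K T_lat > 0` such that every cold-start
strong solution at `β' = (γ ε_K)⁻¹/2` has its physical-time Cesàro mean `T⁻¹ ∫₀ᵀ E[∏ avgObs (U(s/ε_K))] ds`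
within `δ` of `expectAt K os` — the plan-only rung `stub_fixedCutoffMixing` of crux K_A1. -/
theorem fixedCutoffMixing_of_latticeErgodic
    (hErg : ∀ (L : ℕ) [NeZero L] (β' : ℝ)
      (f : GaugeConfig 3 L (Matrix.specialUnitaryGroup (Fin 2) ℂ) → ℝ), Measurable f → (∀ V, |f V| ≤ 1) →
      ∀ δ : ℝ, 0 < δ → ∃ T₀ : ℝ, 0 < T₀ ∧ ∀ T : ℝ, T₀ ≤ T →
        ∀ (Ω : Type) (mΩ : MeasurableSpace Ω) (P : Measure Ω) (hP : IsProbabilityMeasure P)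
          (W : ℝ≥0 → Ω → (Edge 3 L × NoiseIdx 2 → ℝ)) (hW : IsFlatBrownian W P)
          (U : ℝ≥0 → Ω → GaugeConfig 3 L (Matrix.specialUnitaryGroup (Fin 2) ℂ)),
          (∀ ω, U 0 ω = fun _ => 1) →
          (latticeLangevinDynamics (fundamentalLatticeRep 2) β').IsSolution (fundamentalRep (Fin 2))
            hW.natFiltration P W U →
          |(∫ V, f V ∂(wilsonMeasure (d := 3) (L := L) (fundamentalRep (Fin 2)) β')) -
              T⁻¹ * ∫ t in (0 : ℝ)..T, (∫ ω, f (U t.toNNReal ω) ∂P)| ≤ δ)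
    (hDict : ∀ (F : T3ContinuumYM3Torus.T3Family) (γ : ℝ) (K : ℕ) (os : List (T3ContinuumYM3Torus.ULoop3 F)),
      (F.scheme (ExpMeanLog.expMeanLogSU : LoopAverage (Matrix.specialUnitaryGroup (Fin 2) ℂ)) γ).expectAt K os =
        ∫ V, (os.map fun C => F.avgObs (ExpMeanLog.expMeanLogSU :
            LoopAverage (Matrix.specialUnitaryGroup (Fin 2) ℂ)) K C
          (fun b : PBond (F.P K) 0 => V (b.src, b.dir))).prod
          ∂(wilsonMeasure (d := 3) (L := (F.P K).sitesPerDir 0) (fundamentalRep (Fin 2)) ((γ * (F.P K).eps)⁻¹ / 2)))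
    (hObs : ∀ (F : T3ContinuumYM3Torus.T3Family) (K : ℕ) (os : List (T3ContinuumYM3Torus.ULoop3 F)),
      Measurable (fun V : GaugeConfig 3 ((F.P K).sitesPerDir 0) (Matrix.specialUnitaryGroup (Fin 2) ℂ) =>
        (os.map fun C => F.avgObs (ExpMeanLog.expMeanLogSU :
            LoopAverage (Matrix.specialUnitaryGroup (Fin 2) ℂ)) K C
          (fun b : PBond (F.P K) 0 => V (b.src, b.dir))).prod) ∧
      ∀ V : GaugeConfig 3 ((F.P K).sitesPerDir 0) (Matrix.specialUnitaryGroup (Fin 2) ℂ),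
        |(os.map fun C => F.avgObs (ExpMeanLog.expMeanLogSU :
            LoopAverage (Matrix.specialUnitaryGroup (Fin 2) ℂ)) K C
          (fun b : PBond (F.P K) 0 => V (b.src, b.dir))).prod| ≤ 1) :
    ∀ (F : T3ContinuumYM3Torus.T3Family) (γ : ℝ), 0 < γ →
      ∀ (os : List (T3ContinuumYM3Torus.ULoop3 F)) (δ : ℝ), 0 < δ → ∀ K : ℕ, ∃ T : ℝ, 0 < T ∧
        ∀ (Ω : Type) (mΩ : MeasurableSpace Ω) (P : Measure Ω) (hP : IsProbabilityMeasure P)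
          (W : ℝ≥0 → Ω → (Edge 3 ((F.P K).sitesPerDir 0) × NoiseIdx 2 → ℝ)) (hW : IsFlatBrownian W P)
          (U : ℝ≥0 → Ω → GaugeConfig 3 ((F.P K).sitesPerDir 0) (Matrix.specialUnitaryGroup (Fin 2) ℂ)),
          (∀ ω, U 0 ω = fun _ => 1) →
          (latticeLangevinDynamics (fundamentalLatticeRep 2) ((γ * (F.P K).eps)⁻¹ / 2)).IsSolution
            (fundamentalRep (Fin 2)) hW.natFiltration P W U →
          |(F.scheme (ExpMeanLog.expMeanLogSU : LoopAverage (Matrix.specialUnitaryGroup (Fin 2) ℂ)) γ).expectAt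
                K os -
              T⁻¹ * ∫ s in (0 : ℝ)..T, (∫ ω, (os.map fun C => F.avgObs (ExpMeanLog.expMeanLogSU :
                  LoopAverage (Matrix.specialUnitaryGroup (Fin 2) ℂ)) K C
                (fun b : PBond (F.P K) 0 => U (s / (F.P K).eps).toNNReal ω (b.src, b.dir))).prod ∂P)| ≤ δ := by
  intro F γ _hγ os δ hδ K
  obtain ⟨hfm, hfb⟩ := hObs F K os
  obtain ⟨T₀, hT₀, hT⟩ := hErg ((F.P K).sitesPerDir 0) ((γ * (F.P K).eps)⁻¹ / 2) _ hfm hfb δ hδ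
  have hε : 0 < (F.P K).eps := (F.P K).eps_pos
  refine ⟨(F.P K).eps * T₀, mul_pos hε hT₀, fun Ω mΩ P hP W hW U hU0 hsol => ?_⟩
  have key := hT T₀ le_rfl Ω mΩ P hP W hW U hU0 hsol
  rw [hDict F γ K os]
  have hchange := inv_mul_integral_comp_div
    (fun t : ℝ => ∫ ω, (os.map fun C => F.avgObs (ExpMeanLog.expMeanLogSU :
        LoopAverage (Matrix.specialUnitaryGroup (Fin 2) ℂ)) K C
      (fun b : PBond (F.P K) 0 => U t.toNNReal ω (b.src, b.dir))).prod ∂P) hε.ne' hT₀.ne'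
  rw [hchange]
  exact key

end Summit.QuantumFields.YangMills.Theorems.ColdStartUniversality

end
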